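import Mathlib
import Summits.Ventures.PercRepro.TriangleCapDeepThreeBound
import Summits.Ventures.PercRepro.TriangleCapDeepThreeWitness
import Summits.Ventures.PercRepro.TriangleCapDeepThreeValues

/-!
# PercRepro — THE DEEP SUB-BANDS ON `4 + (s − t)` VERTICES, EXACTLY (p3, gen 54; part 284)

On `4 + (s − t)` vertices (three non-neighbours of the vertex `w` of degree `s − t`, `2 t ≤ s`) the sub-band `u` of
the band `t` is the set of band values `2 j` of the triangle-free graphs whose off-edge graph has MAXIMUM degree
exactly `t − u`.  In the DEEP regime `t/2 < u ≤ 2t/3`, `u + 3 ≤ t` (so `D = t − u` satisfies `3 ≤ D`, `2 D < t ≤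
3 D`):

  **the sub-band `u` is exactly `[(t − u − 1)(3 u − t), deepTop t 2 u / 2]`, minus the single value
  `(t − u − 1)(3 u − t) + 1` when `3 u = 2 t`**   (`deep_subband_three`)

— the bottom `(t − u − 1)(3 u − t) = B(u) + (t − u − 1)(2 u − t)` is the nested bipartite configuration with left
degrees `(D, D, t − 2 D)` (part 281: the deficiency identity with the spread bound), the top is the two-carrier
round robin `deepTop t 2 u` (the sub-band bound of part 257 at `ℓ = 3`), every value in between is the deep witness
family of part 282 with left degrees `(D, c₂, u − c₂)`, `α` full rows and `β` pair rows (the values of part 283),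
and at `t = 3 D` the rigid bottom `K_{3,D}` has no neighbour: its rows are full, one partial row is impossible mod 3
(`deep_three_not_bottom_succ`).  The census of mining/p3/g54 (45 cells `7 ≤ t ≤ 24`): verbatim.
Axioms: standard.
-/

namespace PercRepro

namespace TriangleCap

namespace C047

open Finset

variable {V : Type*} [Fintype V] [DecidableEq V]

/-- A graph on `4 + (s − t)` vertices with a vertex of degree `s − t` has three non-neighbours of it. -/
theorem card_nonNbrs_three (s t : ℕ) (H : SimpleGraph (Fin (3 + 1 + (s - t)))) [DecidableRel H.Adj]
    (w : Fin (3 + 1 + (s - t))) (hw : deg H w + t = s) : (nonNbrs H w).card = 3 := by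
  have := card_nonNbrs_add H w
  rw [Fintype.card_fin] at this
  omega

/-- In the deep regime a vertex of maximal off-degree `t − u` can be taken among the non-neighbours. -/
theorem exists_nonNbr_offDeg_eq (H : SimpleGraph V) [DecidableRel H.Adj]
    (hfree : H.CliqueFree 3) (w : V) (t D : ℕ) (ht : (offEdges H w).card = t) (hℓ : (nonNbrs H w).card = 3)
    (hD : ∀ v, offDeg H w v ≤ D) (hD3 : 3 ≤ D) (htD : 2 * D < t) (x : V) (hx : offDeg H w x = D) :
    ∃ x', x' ∈ nonNbrs H w ∧ offDeg H w x' = D := by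
  by_cases hxL : x ∈ nonNbrs H w
  · exact ⟨x, hxL, hx⟩
  · rw [mem_nonNbrs] at hxL
    have hxw : x ≠ w := by
      intro h
      rw [h, offDeg_self] at hx
      omega
    have hadj : H.Adj w x := by
      by_contra h
      exact hxL ⟨hxw, h⟩
    have h3 := offDeg_le_card_nonNbrs_of_adj H hfree w x hadj
    rw [hx, hℓ] at h3
    have hD' : D = 3 := by omega
    by_contra hno
    simp only [not_exists, not_and] at hno
    have hlt : ∀ x' ∈ nonNbrs H w, offDeg H w x' ≤ 2 := by
      intro x' hx'
      have := hD x'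
      have := hno x' hx'
      omega
    have hsum := sum_offDeg_nonNbrs_ge H hfree w
    have hle : ∑ x' ∈ nonNbrs H w, offDeg H w x' ≤ ∑ _x' ∈ nonNbrs H w, 2 := sum_le_sum hlt
    rw [sum_const, hℓ, smul_eq_mul] at hle
    omega

/-- The bottom identity: `t (t − 1) + 2 D = 2 (D − 1)(D + 2 r) + 2 D (D − 1) + r (r − 1) + 4 u` for `t = 2 D + r`,
`u = D + r`. -/
theorem deep_three_poly (D r : ℕ) (hD : 1 ≤ D) (hr : 1 ≤ r) :
    (2 * D + r) * (2 * D + r - 1) + 2 * D =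
      2 * ((D - 1) * (D + 2 * r)) + 2 * (D * (D - 1)) + r * (r - 1) + 4 * (D + r) := by
  obtain ⟨D', rfl⟩ : ∃ D', D = D' + 1 := ⟨D - 1, by omega⟩
  obtain ⟨r', rfl⟩ : ∃ r', r = r' + 1 := ⟨r - 1, by omega⟩
  have e1 : 2 * (D' + 1) + (r' + 1) - 1 = 2 * D' + r' + 2 := by omega
  have e2 : D' + 1 - 1 = D' := by omega
  have e3 : r' + 1 - 1 = r' := by omega
  rw [e1, e2, e3]
  ring

/-- **THE DEEP SUB-BAND `u` ON `4 + (s − t)` VERTICES, EXACTLY:** for `t + 1 ≤ 2 u`, `3 u ≤ 2 t`, `u + 3 ≤ t`,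
`2 t ≤ s`, a value `j` is the band value of a triangle-free graph on `4 + (s − t)` vertices with `s` edges, a
vertex `w` of degree `s − t` and maximum off-degree exactly `t − u` IFF
`(t − u − 1)(3 u − t) ≤ j`, `2 j ≤ deepTop t 2 u`, and `j ≠ (t − u − 1)(3 u − t) + 1` when `3 u = 2 t`. -/
theorem deep_subband_three (s t u j : ℕ) (hu : t + 1 ≤ 2 * u) (hu2 : 3 * u ≤ 2 * t) (hD : u + 3 ≤ t)
    (hs : 2 * t ≤ s) :
    (∃ (H : SimpleGraph (Fin (3 + 1 + (s - t)))) (_ : DecidableRel H.Adj), H.CliqueFree 3 ∧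
      H.edgeFinset.card = s ∧ ∃ w, deg H w + t = s ∧ (∀ v, offDeg H w v + u ≤ t) ∧
        (∃ x, offDeg H w x + u = t) ∧
        ∑ v, deg H v * deg H v + 2 * (t * (s - t - 1)) + 2 * j = s * (s + 1)) ↔
    ((t - u - 1) * (3 * u - t) ≤ j ∧ 2 * j ≤ deepTop t 2 u ∧
      (3 * u = 2 * t → j ≠ (t - u - 1) * (3 * u - t) + 1)) := by
  constructor
  · rintro ⟨H, _, hfree, hsH, w, hw, hmax, ⟨x, hx⟩, hj⟩
    have hℓ := card_nonNbrs_three s t H w hw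
    have hw1 : 1 ≤ deg H w := by omega
    have htE : (offEdges H w).card = t := by
      have := card_offEdges_add_deg H w
      omega
    have hD' : ∀ v, offDeg H w v ≤ t - u := fun v => by have := hmax v; omega
    have hD3 : 3 ≤ t - u := by omega
    have htD : 2 * (t - u) < t := by omega
    have hlow := deep_three_lower_bound H hfree s t j (t - u) hsH w hw hw1 hj hD' hℓ hD3 htD
    have e1 : 2 * t - 3 * (t - u) = 3 * u - t := by omega
    rw [e1] at hlow
    refine ⟨hlow.2, ?_, fun h3 => ?_⟩
    · obtain ⟨x', hx'L, hx'⟩ := exists_nonNbr_offDeg_eq H hfree w t (t - u) htE hℓ hD' hD3 htD x (by omega)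
      rw [mem_nonNbrs] at hx'L
      have hq : 1 ≤ subQ 3 u := le_max_left 1 _
      have hub := subband_upper_bound_vertices 3 s t H hfree hsH w hw hw1 u j hj x' (by omega) hx'L.2 (by omega)
        (subQ 3 u) hq
      have hw3 := width_of_tangent 3 t u j (by norm_num) hub
      rw [deepTop_three_eq t u (by omega)]
      exact hw3
    · have h3' : t = 3 * (t - u) := by omega
      have := deep_three_not_bottom_succ H hfree s t j (t - u) hsH w hw hw1 hj hD' hℓ hD3 h3'
      rw [e1] at this
      exact this
  · rintro ⟨hlo, hhi, hexc⟩
    -- the parameters `D = t − u`, `r = u − D`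
    set D := t - u with hDdef
    obtain ⟨r, hr⟩ : ∃ r, u = D + r := ⟨u - D, by omega⟩
    have htDr : t = 2 * D + r := by omega
    have hD3 : 3 ≤ D := by omega
    have hr1 : 1 ≤ r := by omega
    have hrD : r ≤ D := by omega
    have hu2' : 2 ≤ u := by omega
    -- the identities, with every product an atom
    have hid := subband_identity t u (by omega)
    have hdt : deepTop t 2 u = 2 * (u * (t - u - 1)) + (u * (u + 1) - coll u (lfRR 2 0)) := rfl
    rw [← hDdef] at hid hdt
    rw [hdt] at hhi
    have hcl := coll_le u (lfRR 2 0)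
    have hcoll := coll_lfRR_two_eq u
    have h2hD := two_mul_halfColl u D
    have hrD' : u - D = r := by omega
    rw [hrD'] at h2hD
    have hu1 : u * (u - 1) ≤ u * (u + 1) := Nat.mul_le_mul_left u (by omega)
    have hbot : (t - u - 1) * (3 * u - t) = (D - 1) * (D + 2 * r) := by
      have e1 : t - u - 1 = D - 1 := by omega
      have e2 : 3 * u - t = D + 2 * r := by omega
      rw [e1, e2]
    rw [hbot] at hlo hexc
    have hpoly := deep_three_poly D r (by omega) (by omega)
    rw [← htDr, ← hr] at hpoly
    set Q := t * (t - 1) with hQ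
    set DD := D * (D - 1) with hDD
    set A := u * (D - 1) with hA
    set P := u * (u + 1) with hP
    set C := coll u (lfRR 2 0) with hC
    set G := u * (u - 1) with hG
    set RR := r * (r - 1) with hRR
    set B := (D - 1) * (D + 2 * r) with hB
    set hmin := halfColl u ((u + 1) / 2) with hhmin
    set hD := halfColl u D with hhD
    -- the doubled value `Q − 2 j − DD` is even: `2 y`
    have hev : Even (Q - 2 * j - DD) := by
      rw [Nat.even_sub (by omega), Nat.even_sub (by omega)]
      have h1 : Even Q := Nat.even_mul_pred_self t
      have h2 : Even DD := Nat.even_mul_pred_self D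
      have h3 : Even (2 * j) := even_two_mul j
      tauto
    obtain ⟨y, hy⟩ := hev
    have hy2 : Q - 2 * j - DD = 2 * y := by omega
    have hlo' : hmin ≤ y := by omega
    have hhi' : y ≤ hD + 2 * u - D := by omega
    have hexc' : u = 2 * D → y + 1 ≠ hD + 2 * u - D := by
      intro h2D heq
      exact hexc (by omega) (by omega)
    obtain ⟨c₂, α, β, hc1, hc2, hα, hαβ, hval⟩ := deep_three_values u D y hD3 (by omega) (by omega) hlo' hhi' hexc'
    have h2hc := two_mul_halfColl u c₂
    set hc := halfColl u c₂ with hhc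
    set CC := c₂ * (c₂ - 1) with hCC
    set KK := (u - c₂) * (u - c₂ - 1) with hKK
    obtain ⟨H, inst, hfree, hsH, w, hw, hmax, ⟨x, hxw, hx⟩, hjH⟩ :=
      deepThreeWitness s t D c₂ (u - c₂) α β hD3 hc2 (by omega) (by omega) hα hαβ hs
    refine ⟨H, inst, hfree, hsH, w, hw, fun v => ?_, ⟨x, ?_⟩, ?_⟩
    · have := hmax v
      omega
    · omega
    · have e : Q - (DD + CC + KK + 6 * α + 2 * β) = 2 * j := by omega
      rw [e] at hjH
      exact hjH

end C047

end TriangleCap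

end PercRepro
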